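import Summits.Ventures.PercRepro.RankLevelSetLevelSixHeavyCellSq27DI2V
import Summits.Ventures.PercRepro.RankLevelSetCoreSixColoopFreeUnion
import Summits.Ventures.PercRepro.RankLevelSetLevelSixCapGlue25
import Summits.Ventures.PercRepro.TriangleCapEightI
import Summits.Ventures.PercRepro.S1TrianglePlusSharp
import Summits.Ventures.PercRepro.S1SeriesLever14
import Summits.Ventures.PercRepro.RankLevelSetCircuitUnionRank
import Summits.Ventures.PercRepro.RankLevelSetDepCountHeavyB
import Summits.Ventures.PercRepro.RankLevelSetFourCircuitNullityFourSharp
import Summits.Ventures.PercRepro.RankLevelSetFiveCircuitNullityFourSharp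
import Summits.Ventures.PercRepro.RankLevelSetLevelSixArithHeavySq20TN11A
import Summits.Ventures.PercRepro.RankLevelSetLevelSixT23Cell11A
import Summits.Ventures.PercRepro.S2CoreSeventeenSplit
import Summits.Ventures.PercRepro.RankLevelSetCoreSixColoopFree
import Summits.Ventures.PercRepro.S3SixWindow

/-!
# PercRepro — THE 23 ROW, CORANK 11, PART B: THE EVERY-CORE TERMINAL AT LEVEL 3 AND THE CORE CELL (23, 11) BY THE 3-LEVEL COLOOP SPLIT (p8 g11, S3)

`proofs/SUBCLAIM-S3-p8.md` §3y. `(phiK (p + 3) 6 / 8)·#U ≤ #Y` on every `e`-free core of rank `p ≥ 20`, corank `11`, on the cell `sq27di2v` with the `H`-term factor `p + 11 − 16` (`ν₁ = 9`, `j = 1`, `j′ = 1`, `|UG| ≤ 19`, `|UH| ≤ 16`, `Kn/Kd = 10408/1000`; `D = C(p + 9, 6)`; caps `s₃ ≤ 24`, `s₄ ≤ 222`, `s₅ ≤ 1985`, `s₆ ≤ 8008`, `s₇ ≤ 19448` at `n₀ = 31`; parts RankLevelSetLevelSixArithHeavySq20TN11A). Axioms: standard.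

`proofs/SUBCLAIM-S3-p8.md` §3y. Every `e`-free core of rank `23`, corank `11`, is coloop-free (the honest cell) or has a coloop `e`, and `M ∖ e` is a core of rank `22`, corank `11`, on which the scaled statement `(Φ(23, 6)/2)·#U ≤ #Y` suffices (`RLS_of_coloop_scaled`, `weighted_of_isColoop_scaled`); the split repeats 3 times down to the every-core terminal at rank `20` (`Φ(23, 6)/8`). Axioms: standard.
-/

open scoped Matroid

namespace PercRepro

namespace ThmN

open Set

variable {α : Type}

-- ===== RankLevelSetLevelSixT23S3Every11 =====


/-- **THE 3-TIMES SCALED EVERY-CORE TERMINAL `(p ≥ 20, 11)` of the `23` row at corank `11`** (level 3, `phiK (p + 3) 6 / 8`, `D = C(p + 9, 6)`). -/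
theorem c025_core_six_t23_scaled3_every11 (M : Matroid α) [M.Finite] (p : ℕ) (hp : 20 ≤ p)
    (hR : M.eRank = (p : ℕ∞)) (hn : M.E.ncard = p + 11)
    (hfree : ∀ e ∈ M.E, ∃ A ⊆ M.E \ {e}, e ∉ M.closure A ∧ e ∉ M.closure ((M.E \ {e}) \ A)) :
    phiK (p + 3) 6 / 8 * (Matroid.topCount M p 6 : ℚ) ≤ (Matroid.midCount M p 6 : ℚ) := by
  classical
  have hd : M.E.encard = M.eRank + (11 : ℕ) := by
    rw [hR, ← M.ground_finite.cast_ncard_eq, hn]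
    push_cast
    ring
  have hL : ∀ e ∈ M.E, ¬ M.IsLoop e := not_isLoop_of_free M hfree
  have hs : ∀ e ∈ M.E, ∀ f ∈ M.E, e ≠ f → M.eRk {e, f} = 2 := by
    intro e he f hf hef
    have h2 : (2 : ℕ∞) ≤ M.eRk {e, f} :=
      two_le_eRk_of_two_le_ncard_of_free M hfree (pair_subset he hf) (by rw [ncard_pair hef])
    have h3 : M.eRk {e, f} ≤ 2 := by
      have := M.eRk_le_encard {e, f}
      rwa [encard_pair hef] at this
    exact le_antisymm h3 h2
  have hc : ∀ X ⊆ M.E, M.eRk X ≤ ((6 - 2 : ℕ) : ℕ∞) → (X.ncard : ℕ∞) ≤ M.eRk X + cnull 4 :=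
    fun X hX hr => nullity_cap_core M hfree 4 (le_refl 4) X hX (by simpa using hr)
  have hc6 : cnull 4 + 1 ≤ 9 := by simp [cnull]
  have hcj : ∀ X ⊆ M.E, M.eRk X ≤ ((6 - 1 - 1 : ℕ) : ℕ∞) → (X.ncard : ℕ∞) ≤ M.eRk X + cnull (4) :=
    fun X hX hr => nullity_cap_core M hfree 4 (by omega) X hX
      (by rwa [show (6 - 1 - 1 : ℕ) = 4 by omega] at hr)
  have hcj' : ∀ X ⊆ M.E, M.eRk X ≤ ((6 - 1 - 1 - 1 : ℕ) : ℕ∞) → (X.ncard : ℕ∞) ≤ M.eRk X + cnull (3) :=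
    fun X hX hr => nullity_cap_core M hfree 3 (by omega) X hX
      (by rwa [show (6 - 1 - 1 - 1 : ℕ) = 3 by omega] at hr)
  have hUG : (Matroid.UG M 6 9).ncard ≤ 19 := by
    have := Matroid.ncard_UG_le (M := M) (q := 6) (ν₁ := 9) (j := 1) (by norm_num) hd hc hc6 hcj (by norm_num [cnull])
    simpa using this
  have hcap : ∀ X ⊆ M.E, ∀ k : ℕ, M.eRk X ≤ k → X.ncard ≤ k + 11 := by
    intro X hX k hr
    have h1 := Matroid.encard_le_eRk_add_of_encard_eq hX hd
    have h2 : X.encard ≤ (k : ℕ∞) + ((11 : ℕ) : ℕ∞) := h1.trans (add_le_add_left hr _)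
    have hfin : X.Finite := M.ground_finite.subset hX
    rw [← hfin.cast_ncard_eq] at h2; exact_mod_cast h2
  have hflat' : ∀ X ⊆ M.E, M.eRk X ≤ ((6 - 1 : ℕ) : ℕ∞) → X.ncard ≤ 16 :=
    fun X hX hr => hcap X hX 5 (by simpa using hr)
  have hUH : (Matroid.UH M 6 9).ncard ≤ 16 :=
    Matroid.ncard_UH_le_of_unique (M := M) (q := 6) (ν₁ := 9) hd hc (by norm_num [cnull]) hflat'
  have hΦ : phiK (p + 3) 6 / 8 ≤ (2 : ℚ) ^ (p + 6) / (((p + 9).choose 6 : ℕ) : ℚ) := by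
    have h := phiK_le_two_pow_div_six (p + 3)
    rw [show p + 3 + 6 = p + 9 by omega] at h
    have h8 : (2 : ℚ) ^ (p + 9) = 2 ^ (p + 6) * 8 := by rw [show p + 9 = p + 6 + 3 by omega, pow_add]; norm_num
    rw [h8] at h
    calc phiK (p + 3) 6 / 8 ≤ (2 : ℚ) ^ (p + 6) * 8 / (((p + 9).choose 6 : ℕ) : ℚ) / 8 := by gcongr
      _ = (2 : ℚ) ^ (p + 6) / (((p + 9).choose 6 : ℕ) : ℚ) := by ring
  exact c025_core_six_heavy_cell_sq27di2v M p 11 9 19 16 0 10408 1000 17 1985 222 24 8008 19448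
      ((p + 9).choose 6) (Nat.choose_pos (by omega)) (phiK (p + 3) 6 / 8) hΦ (by norm_num) (by omega)
      (by norm_num) hUG hUH (by omega) (Or.inl (by norm_num)) (by norm_num) (by norm_num) (by norm_num)
      ((TriangleCap.core_ncard_triangles_le_cq3 M hfree hd).trans (by decide))
      ((ncard_fourCircuits_le_avgChain14 11 M hfree hd).trans (by decide))
      ((S1.ncard_fiveCircuits_le_avgChain5c 11 M hfree hd).trans (by decide))
      ((Matroid.ncard_circuits_le_choose_of_encard M hd 5).trans (by decide))
      ((Matroid.ncard_circuits_le_choose_of_encard M hd 6).trans (by decide))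
      (Or.inl (tail_six_heavy_sq20TN11_11 p hp)) hR hn hfree (level_six_poly_heavy_sq20TN11_11 p hp)

-- ===== RankLevelSetLevelSixT23Split11 =====


/-- **The 3-times scaled cell on EVERY `e`-free core of rank `20`, corank `11`.** -/
theorem c025_core_six_t23_scaled3_all11 (M : Matroid α) [M.Finite]
    (hR : M.eRank = (20 : ℕ∞)) (hn : M.E.ncard = 20 + 11)
    (hfree : ∀ e ∈ M.E, ∃ A ⊆ M.E \ {e}, e ∉ M.closure A ∧ e ∉ M.closure ((M.E \ {e}) \ A)) :
    phiK (20 + 3) 6 / 8 * (Matroid.topCount M 20 6 : ℚ) ≤ (Matroid.midCount M 20 6 : ℚ) := by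
  exact c025_core_six_t23_scaled3_every11 M 20 (le_refl 20) hR hn hfree

/-- **The 2-times scaled cell on EVERY `e`-free core of rank `21`, corank `11`.** -/
theorem c025_core_six_t23_scaled2_all11 (M : Matroid α) [M.Finite]
    (hR : M.eRank = (21 : ℕ∞)) (hn : M.E.ncard = 21 + 11)
    (hfree : ∀ e ∈ M.E, ∃ A ⊆ M.E \ {e}, e ∉ M.closure A ∧ e ∉ M.closure ((M.E \ {e}) \ A)) :
    phiK (21 + 2) 6 / 4 * (Matroid.topCount M 21 6 : ℚ) ≤ (Matroid.midCount M 21 6 : ℚ) := by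
  by_cases hc : ∃ e ∈ M.E, M.IsColoop e
  · obtain ⟨e, _, hce⟩ := hc
    have hR' : M.eRank = ((20 + 1 : ℕ) : ℕ∞) := by rw [hR]; norm_num
    obtain ⟨hn20, hR20, hfree20, -⟩ := delete_core_data M hce hR' (by omega) hfree
    have h := c025_core_six_t23_scaled3_every11 (M ＼ {e}) 20 (le_refl 20) hR20 hn20 hfree20
    have h' : phiK (21 + 2) 6 / 4 / 2 * (Matroid.topCount (M ＼ {e}) 20 6 : ℚ) ≤
        (Matroid.midCount (M ＼ {e}) 20 6 : ℚ) := by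
      have e1 : phiK (21 + 2) 6 / 4 / 2 = phiK (20 + 3) 6 / 8 := by
        rw [show (21 + 2 : ℕ) = 20 + 3 by norm_num]; ring
      rw [e1]; exact h
    exact weighted_of_isColoop_scaled M hce (by norm_num) hR' (phiK (21 + 2) 6 / 4) h'
  · exact c025_core_six_t23_scaled2_cf11 M 21 (le_refl 21) (fun e he hce => hc ⟨e, he, hce⟩) hR hn hfree

/-- **The 1-times scaled cell on EVERY `e`-free core of rank `22`, corank `11`.** -/
theorem c025_core_six_t23_scaled1_all11 (M : Matroid α) [M.Finite]
    (hR : M.eRank = (22 : ℕ∞)) (hn : M.E.ncard = 22 + 11)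
    (hfree : ∀ e ∈ M.E, ∃ A ⊆ M.E \ {e}, e ∉ M.closure A ∧ e ∉ M.closure ((M.E \ {e}) \ A)) :
    phiK (22 + 1) 6 / 2 * (Matroid.topCount M 22 6 : ℚ) ≤ (Matroid.midCount M 22 6 : ℚ) := by
  by_cases hc : ∃ e ∈ M.E, M.IsColoop e
  · obtain ⟨e, _, hce⟩ := hc
    have hR' : M.eRank = ((21 + 1 : ℕ) : ℕ∞) := by rw [hR]; norm_num
    obtain ⟨hn21, hR21, hfree21, -⟩ := delete_core_data M hce hR' (by omega) hfree
    have h := c025_core_six_t23_scaled2_all11 (M ＼ {e}) hR21 hn21 hfree21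
    have h' : phiK (22 + 1) 6 / 2 / 2 * (Matroid.topCount (M ＼ {e}) 21 6 : ℚ) ≤
        (Matroid.midCount (M ＼ {e}) 21 6 : ℚ) := by
      have e1 : phiK (22 + 1) 6 / 2 / 2 = phiK (21 + 2) 6 / 4 := by
        rw [show (22 + 1 : ℕ) = 21 + 2 by norm_num]; ring
      rw [e1]; exact h
    exact weighted_of_isColoop_scaled M hce (by norm_num) hR' (phiK (22 + 1) 6 / 2) h'
  · exact c025_core_six_t23_scaled1_cf11 M 22 (le_refl 22) (fun e he hce => hc ⟨e, he, hce⟩) hR hn hfree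

/-- **The core cell `(23, 11)`, every `e`-free core.** -/
theorem c025_core_six_twentythree_11 (M : Matroid α) [M.Finite]
    (hR : M.eRank = (23 : ℕ∞)) (hn : M.E.ncard = 23 + 11)
    (hfree : ∀ e ∈ M.E, ∃ A ⊆ M.E \ {e}, e ∉ M.closure A ∧ e ∉ M.closure ((M.E \ {e}) \ A)) :
    RLS M 23 6 := by
  by_cases hc : ∃ e ∈ M.E, M.IsColoop e
  · obtain ⟨e, _, hce⟩ := hc
    have hR' : M.eRank = ((22 + 1 : ℕ) : ℕ∞) := by rw [hR]; norm_num
    obtain ⟨hn22, hR22, hfree22, -⟩ := delete_core_data M hce hR' (by omega) hfree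
    exact RLS_of_coloop_scaled M hce (by norm_num) hR'
      (c025_core_six_t23_scaled1_all11 (M ＼ {e}) hR22 hn22 hfree22)
  · exact c025_core_six_t23_free11 M 23 (le_refl 23) (fun e he hce => hc ⟨e, he, hce⟩) hR hn hfree

end ThmN

end PercRepro
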